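import Summits.BirchSwinnertonDyer.BirchSwinnertonDyer.Theorems.AlignedTransportAtTwoBSDOfMainConjectureRankOneAtTwoSigmaSqTwoNetting
import Literature.NumberTheory.EllipticCurves.PadicSigmaSqVariableChangeProofs
import Literature.NumberTheory.EllipticCurves.PAdicGrossZagierConstantTermProofs
import Mathlib.NumberTheory.Padics.Hensel
import HarnessLib

/-!
# The PRINT stub `stub_sigmaSqTwo` of crux C3′ NETTED to a TWO-PARAMETER CHART: Mazur–Tate's `σ²` at `p = 2`
# exists uniquely as soon as every chart curve `y² + xy = x³ + a₂x² + a₆` (`a₂ ∈ ℤ₂`, `a₆ ∈ ℤ₂ˣ`) carries a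
# sigma-squared pair over `ℚ₂` (route-independent)

Cell `bsd-f1-sign2`, WIDTH-5 attach seat `bsd-line-att-p3` g8 on `route-BirchSwinnertonDyer-AlignedTransportAtTwo`
(line `birth` of crux C3′ stmt-BirchSwinnertonDyer-23008, registered stub `stub_sigmaSqTwo :
Literature.NumberTheory.EllipticCurves.mazurTate_sigmaSq_existsUnique_two`). SUPPORT file
(`--supports stmt-BirchSwinnertonDyer-23008`), sequel of `…SigmaSqTwoNetting.lean` (p624769): THEOREMS ONLY, no
definition, no named fact, no `sorry`. BSD is not proved by any of this; the PRINT fact is NOT discharged here.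

The sequel nets the fact further, to the shape a Blakestad–Grant-type UNIVERSAL construction at `p = 2` delivers.
At an ordinary `2` the Hasse invariant is `a₁`, so `a₁ ∈ ℤ₂ˣ` and the `ℤ₂`-integral change of variables
`[u = a₁; r, 0, t]` with `t` the Hensel root of `12t² + (12a₃ − 4a₁a₂ − a₁³)t + (a₁²a₄ − 2a₁a₂a₃ + 3a₃²) = 0`
(linear coefficient a unit, leading coefficient `≡ 0 (mod 4)`) and `r = −(a₃ + 2t)/a₁` carries every `2`-integral
equation with `a₁ ∈ ℤ₂ˣ` to the CHART `y² + xy = x³ + a₂x² + a₆` (`a₁ = 1`, `a₃ = a₄ = 0`), whose discriminant is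
`−a₆((1 + 4a₂)³ + 432a₆)`; good reduction survives (`u` a unit), so the chart coefficient `a₆` is a unit.
Sigma-squared pairs transport along `ℤ₂`-integral changes of variables with unit `u` (tree
`exists_isMazurTateSigmaSqPair_of_variableChange`). Hence:

* §1 `exists_variableChange_chart` — every `V₀/ℤ₂` with `a₁ ∈ ℤ₂ˣ` is `ℤ₂`-isomorphic to a chart curve
  `⟨1, b₂, 0, 0, b₆⟩`; `isUnit_a₆_of_chart` — with `b₆ ∈ ℤ₂ˣ` when `Δ(V₀) ∈ ℤ₂ˣ`.
* §2 `exists_isMazurTateSigmaSqPair_of_chart` — a sigma-squared pair of the chart curve gives one of `V₀ ⊗ ℚ₂`.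
* §3 **`mazurTate_sigmaSq_existsUnique_two_of_forall_chart`**: the PRINT fact follows from
  «for all `b₂ ∈ ℤ₂`, `b₆ ∈ ℤ₂ˣ`, the curve `y² + xy = x³ + b₂x² + b₆` over `ℚ₂` carries SOME sigma-squared pair»
  — a statement about ONE explicit two-parameter family, the universal ordinary `a₁`-chart
  `R̂₂ = ℤ₂[b₂, b₆, b₆⁻¹, …]^` of a `p = 2` Blakestad–Grant tower (cf. the tree's `a₂`-chart at `p = 3`,
  `PadicSigmaThree*`).

## Sources

* B. Mazur, J. Tate, *The `p`-adic sigma function*, Duke Math. J. 62 (1991), Thm. 3.1. [cite: MazurTate1991, Thm. 3.1]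
* J. H. Silverman, Math. Ann. 332 (2005), §5 Rem. 2. [cite: Silverman2005DivPoly, §5 Rem. 2]
* C. Blakestad, D. Grant, J. Number Theory 249 (2023), Thm. 1 and Thm. 15 (universal curve and specialisation).
  [cite: BlakestadGrant2023, Thm. 15]
* J. H. Silverman, *AEC* 2nd ed., III.1 (admissible changes of variables), VII.1 Prop. 1.3, Appendix A
  Prop. 1.1 (normal forms with `a₁ ≠ 0` in characteristic `2`). [cite: SilvermanAEC2009, Appendix A Prop. 1.1]
-/

noncomputable section

set_option linter.dupNamespace false
set_option autoImplicit false

open scoped Classical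
open PowerSeries WeierstrassCurve Literature.NumberTheory.EllipticCurves

namespace Summit.BirchSwinnertonDyer.BirchSwinnertonDyer.Theorems.AlignedTransportAtTwoSigmaSqTwo

/-! ## §1 The chart `y² + xy = x³ + a₂x² + a₆` is reached over `ℤ₂` whenever `a₁ ∈ ℤ₂ˣ` -/

/-- **Hensel step.** For `a₁ ∈ ℤ₂ˣ` the quadratic `12t² + Bt + C₀`, `B = 12a₃ − 4a₁a₂ − a₁³` (a unit),
`C₀ = a₁²a₄ − 2a₁a₂a₃ + 3a₃²`, has a root `t ∈ ℤ₂` (Newton from `t₀ = −C₀/B`: `‖F(t₀)‖ = ‖12C₀²/B²‖ ≤ ¼ < 1 =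
‖F'(t₀)‖²`). [cite: SilvermanAEC2009, Appendix A Prop. 1.1] -/
theorem exists_root_chart_quadratic (a₁ a₂ a₃ a₄ : ℤ_[2]) (ha : IsUnit a₁) :
    ∃ t : ℤ_[2], 12 * t ^ 2 + (12 * a₃ - 4 * a₁ * a₂ - a₁ ^ 3) * t + (a₁ ^ 2 * a₄ - 2 * a₁ * a₂ * a₃ + 3 * a₃ ^ 2) = 0 := by
  set B : ℤ_[2] := 12 * a₃ - 4 * a₁ * a₂ - a₁ ^ 3 with hB
  set C₀ : ℤ_[2] := a₁ ^ 2 * a₄ - 2 * a₁ * a₂ * a₃ + 3 * a₃ ^ 2 with hC₀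
  -- `B` is a unit: `B = -a₁³ + 2·(…)`
  have h2 : ‖(2 : ℤ_[2])‖ < 1 := by
    have h : ‖((2 : ℕ) : ℤ_[2])‖ = ((2 : ℕ) : ℝ)⁻¹ := PadicInt.norm_p
    rw [Nat.cast_ofNat] at h
    rw [h]; norm_num
  have ha1 : ‖a₁‖ = 1 := PadicInt.isUnit_iff.mp ha
  have hBunit : ‖B‖ = 1 := by
    have hsplit : B = -a₁ ^ 3 + 2 * (6 * a₃ - 2 * a₁ * a₂) := by rw [hB]; ring
    have hsmall : ‖(2 : ℤ_[2]) * (6 * a₃ - 2 * a₁ * a₂)‖ < 1 := by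
      rw [norm_mul]
      exact mul_lt_one_of_nonneg_of_lt_one_left (norm_nonneg _) h2 (PadicInt.norm_le_one _)
    have hbig : ‖-a₁ ^ 3‖ = 1 := by rw [norm_neg, norm_pow, ha1, one_pow]
    rw [hsplit, PadicInt.norm_add_eq_max_of_ne (by rw [hbig]; exact hsmall.ne'), hbig, max_eq_left hsmall.le]
  have hBu : IsUnit B := PadicInt.isUnit_iff.mpr hBunit
  obtain ⟨Bu, hBu'⟩ := hBu
  -- the polynomial and the starting point
  set F : Polynomial ℤ_[2] := Polynomial.C 12 * Polynomial.X ^ 2 + Polynomial.C B * Polynomial.X + Polynomial.C C₀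
    with hF
  set t₀ : ℤ_[2] := -(C₀ * ↑Bu⁻¹) with ht₀
  have hFeval : ∀ z : ℤ_[2], F.aeval z = 12 * z ^ 2 + B * z + C₀ := by
    intro z; simp [hF]
  have hFder : ∀ z : ℤ_[2], F.derivative.aeval z = 24 * z + B := by
    intro z
    simp [hF]
    ring
  have hBt₀ : B * t₀ = -C₀ := by
    rw [ht₀, ← hBu', mul_neg, ← mul_assoc, mul_comm (Bu : ℤ_[2]) C₀, mul_assoc, Units.mul_inv, mul_one]
  have hF0 : F.aeval t₀ = 12 * t₀ ^ 2 := by rw [hFeval]; linear_combination hBt₀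
  have hder1 : ‖F.derivative.aeval t₀‖ = 1 := by
    rw [hFder]
    have hsmall : ‖(24 : ℤ_[2]) * t₀‖ < 1 := by
      rw [show (24 : ℤ_[2]) = 2 * 12 by norm_num, mul_assoc, norm_mul]
      exact mul_lt_one_of_nonneg_of_lt_one_left (norm_nonneg _) h2 (PadicInt.norm_le_one _)
    rw [add_comm, PadicInt.norm_add_eq_max_of_ne (by rw [hBunit]; exact hsmall.ne'), hBunit, max_eq_left hsmall.le]
  have hnorm : ‖F.aeval t₀‖ < ‖F.derivative.aeval t₀‖ ^ 2 := by
    rw [hder1, one_pow, hF0, show (12 : ℤ_[2]) = 2 * 6 by norm_num, mul_assoc, norm_mul]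
    exact mul_lt_one_of_nonneg_of_lt_one_left (norm_nonneg _) h2 (PadicInt.norm_le_one _)
  obtain ⟨t, ht, -⟩ := hensels_lemma hnorm
  exact ⟨t, by rw [← hFeval]; exact ht⟩

/-- An odd integer, or more generally an integer prime to `2`, is a unit of `ℤ₂`. [folklore] -/
theorem isUnit_intCast_padicInt_two {k : ℤ} (hk : ¬ (2 : ℤ) ∣ k) : IsUnit (k : ℤ_[2]) := by
  rw [PadicInt.isUnit_iff]
  refine le_antisymm (PadicInt.norm_le_one _) (not_lt.mp fun hlt ↦ hk ?_)
  exact_mod_cast (PadicInt.norm_int_lt_one_iff_dvd k).mp hlt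

/-- **Every `2`-integral Weierstrass equation with `a₁ ∈ ℤ₂ˣ` is `ℤ₂`-isomorphic to a chart curve
`y² + xy = x³ + b₂x² + b₆`**: the admissible change of variables `[u = a₁; r = −(a₃ + 2t)/a₁, s = 0, t]` with `t`
the Hensel root of `exists_root_chart_quadratic` kills `a₃` and `a₄` and makes `a₁ = 1`. (All of `u⁻¹, r, s, t`
lie in `ℤ₂`, so this is an isomorphism of `ℤ₂`-models.) [cite: SilvermanAEC2009, III.1 (admissible changes of
variables) and Appendix A Prop. 1.1] -/
theorem exists_variableChange_chart (V₀ : WeierstrassCurve ℤ_[2]) (ha : IsUnit V₀.a₁) :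
    ∃ (C : VariableChange ℤ_[2]) (b₂ b₆ : ℤ_[2]), C • V₀ = ⟨1, b₂, 0, 0, b₆⟩ := by
  obtain ⟨t, ht⟩ := exists_root_chart_quadratic V₀.a₁ V₀.a₂ V₀.a₃ V₀.a₄ ha
  set u : ℤ_[2]ˣ := ha.unit with hu
  have hua : (u : ℤ_[2]) = V₀.a₁ := ha.unit_spec
  set v : ℤ_[2] := ((u⁻¹ : ℤ_[2]ˣ) : ℤ_[2]) with hv
  have hva : V₀.a₁ * v = 1 := by rw [← hua, hv, Units.mul_inv]
  set r : ℤ_[2] := -(V₀.a₃ + 2 * t) * v with hr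
  let C : VariableChange ℤ_[2] := ⟨u, r, 0, t⟩
  refine ⟨C, (C • V₀).a₂, (C • V₀).a₆, ?_⟩
  have hCu : ((C.u⁻¹ : ℤ_[2]ˣ) : ℤ_[2]) = v := rfl
  have hCr : C.r = -(V₀.a₃ + 2 * t) * v := rfl
  have hCs : C.s = 0 := rfl
  have hCt : C.t = t := rfl
  have h1 : (C • V₀).a₁ = 1 := by
    rw [variableChange_def]; dsimp only
    rw [hCu, hCs]
    linear_combination hva
  have h3 : (C • V₀).a₃ = 0 := by
    rw [variableChange_def]; dsimp only
    rw [hCu, hCr, hCt]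
    linear_combination (-(v ^ 3) * (V₀.a₃ + 2 * t)) * hva
  have h4 : (C • V₀).a₄ = 0 := by
    rw [variableChange_def]; dsimp only
    rw [hCu, hCr, hCs, hCt]
    -- `v⁴·(a₄ + 2ra₂ − ta₁ + 3r²) = v⁶·Q(t) + (1 − a₁v)·(…)` and `a₁v = 1`, `Q(t) = 0`
    linear_combination (v ^ 6) * ht -
      (v ^ 4 * V₀.a₄ * (1 + v * V₀.a₁) - 2 * (V₀.a₃ + 2 * t) * V₀.a₂ * v ^ 5
        - v ^ 4 * t * V₀.a₁ * (1 + v * V₀.a₁)) * hva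
  ext
  · exact h1
  · rfl
  · exact h3
  · exact h4
  · rfl

/-- On the chart `y² + xy = x³ + b₂x² + b₆` the discriminant is `−b₆((1 + 4b₂)³ + 432b₆)`, so **unit
discriminant forces `b₆ ∈ ℤ₂ˣ`** (indeed `b₆` is a unit iff the chart curve has good reduction). [cite:
SilvermanAEC2009, III.1 (formula for `Δ`) and Appendix A Prop. 1.1] -/
theorem isUnit_a₆_of_chart (V₁ : WeierstrassCurve ℤ_[2]) (h1 : V₁.a₁ = 1) (h3 : V₁.a₃ = 0) (h4 : V₁.a₄ = 0)
    (hΔ : IsUnit V₁.Δ) : IsUnit V₁.a₆ := by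
  have hfac : V₁.Δ = -V₁.a₆ * ((1 + 4 * V₁.a₂) ^ 3 + 432 * V₁.a₆) := by
    simp only [WeierstrassCurve.Δ, WeierstrassCurve.b₂, WeierstrassCurve.b₄, WeierstrassCurve.b₆,
      WeierstrassCurve.b₈, h1, h3, h4]
    ring
  rw [hfac] at hΔ
  simpa using (isUnit_of_mul_isUnit_left hΔ).neg

/-! ## §2 Transport of sigma-squared pairs from the chart model -/

/-- **A sigma-squared pair of a `ℤ₂`-isomorphic model transports**: if `C • V₀` (`C` a change of variables
over `ℤ₂`, so `u ∈ ℤ₂ˣ` and `r, s, t ∈ ℤ₂`) carries a sigma-squared pair over `ℚ₂`, so does `V₀` (tree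
`exists_isMazurTateSigmaSqPair_of_variableChange`: `Σ = u⁻²·Σ' ∘ θ`, `c = u²c' − r`). [cite: MazurSteinTate2006,
Thm. 1.3] [cite: Silverman2005DivPoly, §5 Rem. 2] -/
theorem exists_isMazurTateSigmaSqPair_of_integral_variableChange (V₀ : WeierstrassCurve ℤ_[2])
    (C : VariableChange ℤ_[2])
    (hex : ∃ Sq : ℚ_[2]⟦X⟧, ∃ c : ℚ_[2], ((C • V₀).baseChange ℚ_[2]).IsMazurTateSigmaSqPair Sq c) :
    ∃ Sq : ℚ_[2]⟦X⟧, ∃ c : ℚ_[2], (V₀.baseChange ℚ_[2]).IsMazurTateSigmaSqPair Sq c := by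
  haveI : (V₀.baseChange ℚ_[2]).IsIntegral ℤ_[2] := ⟨⟨V₀, rfl⟩⟩
  have hmap : (C • V₀).baseChange ℚ_[2] = (C.map (algebraMap ℤ_[2] ℚ_[2])) • V₀.baseChange ℚ_[2] := by
    rw [WeierstrassCurve.baseChange, WeierstrassCurve.baseChange, map_variableChange]
  rw [hmap] at hex
  refine exists_isMazurTateSigmaSqPair_of_variableChange ?_ ?_ ?_ ?_ hex
  · change ‖((C.u : ℤ_[2]) : ℚ_[2])‖ = 1
    rw [PadicInt.padic_norm_e_of_padicInt]
    exact PadicInt.isUnit_iff.mp (Units.isUnit C.u)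
  · change ‖((C.r : ℤ_[2]) : ℚ_[2])‖ ≤ 1
    rw [PadicInt.padic_norm_e_of_padicInt]; exact PadicInt.norm_le_one _
  · change ‖((C.s : ℤ_[2]) : ℚ_[2])‖ ≤ 1
    rw [PadicInt.padic_norm_e_of_padicInt]; exact PadicInt.norm_le_one _
  · change ‖((C.t : ℤ_[2]) : ℚ_[2])‖ ≤ 1
    rw [PadicInt.padic_norm_e_of_padicInt]; exact PadicInt.norm_le_one _

/-- **The `ℤ₂`-model of a globally minimal `W/ℚ` read over `ℚ₂` is `W ⊗ ℚ₂`.** [folklore] -/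
theorem baseChange_map_integralModelInt_padic (W : WeierstrassCurve ℚ) [W.IsGloballyMinimal] :
    ((integralModelInt W).map (Int.castRingHom ℤ_[2])).baseChange ℚ_[2] = W.baseChange ℚ_[2] := by
  rw [WeierstrassCurve.baseChange, WeierstrassCurve.baseChange, WeierstrassCurve.map_map]
  conv_rhs => rw [← map_integralModelInt W, WeierstrassCurve.map_map]
  exact congrArg (integralModelInt W).map (RingHom.ext_int _ _)

/-! ## §3 The PRINT fact from the two-parameter chart family -/

/-- **`mazurTate_sigmaSq_existsUnique_two` ⟸ the chart family**: if for every `b₂ ∈ ℤ₂` and every UNIT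
`b₆ ∈ ℤ₂ˣ` the curve `y² + xy = x³ + b₂x² + b₆` over `ℚ₂` carries some Mazur–Tate sigma-squared pair, then the
PRINT fact holds (Mazur–Tate 1991 Thm. 3.1 / Silverman 2005 §5 Rem. 2 at `p = 2`, `∃!` of the sigma-squared
division series for every globally minimal good-ordinary-at-`2` `W/ℚ`). Route: good ordinary at `2` ⟹ `a₁` odd
(unit of `ℤ₂`) and `2 ∤ Δ_min` ⟹ the `ℤ₂`-model is `ℤ₂`-isomorphic to a chart curve with `b₆ ∈ ℤ₂ˣ` (§1) ⟹ its pair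
transports (§2) ⟹ `∃!` by the netting file (`…_iff_forall_exists_pair`). This is the specialisation step
(Blakestad–Grant Thm. 15) of a `p = 2` sigma tower, done once and for all: the universal construction need only
produce a pair for the two-parameter `a₁`-chart. [cite: MazurTate1991, Thm. 3.1] [cite: Silverman2005DivPoly, §5 Rem. 2]
[cite: BlakestadGrant2023, Thm. 15] -/
theorem mazurTate_sigmaSq_existsUnique_two_of_forall_chart
    (H : ∀ b₂ b₆ : ℤ_[2], IsUnit b₆ →
      ∃ Sq : ℚ_[2]⟦X⟧, ∃ c : ℚ_[2],
        ((⟨1, b₂, 0, 0, b₆⟩ : WeierstrassCurve ℤ_[2]).baseChange ℚ_[2]).IsMazurTateSigmaSqPair Sq c) :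
    mazurTate_sigmaSq_existsUnique_two := by
  rw [mazurTate_sigmaSq_existsUnique_two_iff_forall_exists_pair]
  intro W _ _ hgood hord
  set V₀ : WeierstrassCurve ℤ_[2] := (integralModelInt W).map (Int.castRingHom ℤ_[2]) with hV₀
  -- `a₁` and `Δ` of the `ℤ₂`-model are units
  have hodd : Odd (integralModelInt W).a₁ :=
    odd_a₁_of_hasGoodReductionAtPrime_two_of_odd_frobeniusTrace_two W hgood
      (Int.not_even_iff_odd.mp fun h ↦ hord (even_iff_two_dvd.mp h))
  have ha : IsUnit V₀.a₁ := by
    rw [hV₀, map_a₁, eq_intCast]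
    exact isUnit_intCast_padicInt_two fun h ↦ (Int.not_even_iff_odd.mpr hodd) (even_iff_two_dvd.mpr h)
  have hΔ : IsUnit V₀.Δ := by
    rw [hV₀, map_Δ, eq_intCast]
    exact isUnit_intCast_padicInt_two (W.not_dvd_minimalDiscriminantInt_of_hasGoodReductionAtPrime 2 hgood)
  -- the chart model
  obtain ⟨C, b₂, b₆, hC⟩ := exists_variableChange_chart V₀ ha
  have hΔ' : IsUnit (C • V₀).Δ := by
    rw [variableChange_Δ]
    exact ((Units.isUnit _).pow 12).mul hΔ
  have hb₆ : IsUnit b₆ := by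
    have h := isUnit_a₆_of_chart (C • V₀) (by rw [hC]) (by rw [hC]) (by rw [hC]) hΔ'
    rwa [hC] at h
  -- transport the chart pair back to `W ⊗ ℚ₂`
  have hex : ∃ Sq : ℚ_[2]⟦X⟧, ∃ c : ℚ_[2], ((C • V₀).baseChange ℚ_[2]).IsMazurTateSigmaSqPair Sq c := by
    rw [hC]; exact H b₂ b₆ hb₆
  have h := exists_isMazurTateSigmaSqPair_of_integral_variableChange V₀ C hex
  rwa [hV₀, baseChange_map_integralModelInt_padic W] at h

end Summit.BirchSwinnertonDyer.BirchSwinnertonDyer.Theorems.AlignedTransportAtTwoSigmaSqTwo
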